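import Mathlib
import Summits.ValiantsHypothesis.ValiantsHypothesis.Theses.PermanentalCones
import Summits.ValiantsHypothesis.ValiantsHypothesis.Theorems.PermanentalConesPermanentalHyperbolic
import Summits.ValiantsHypothesis.ValiantsHypothesis.Theorems.PermanentalConesPermanentalConeHardSlackAsPermanent
import Literature.AlgebraicGeometry.HyperbolicPolynomials.HyperbolicityCone
import Literature.AlgebraicGeometry.HyperbolicPolynomials.SpectrahedralShadow

/-!
# `PermanentalConeHard` (stmt-ValiantsHypothesis-8654) — pointwise normal form of H+:
# `H+ ↔ NotAShadow ∨ PsdRankUnbounded`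

Route `PermanentalCones` of `ValiantsHypothesis`, crux `PermanentalConeHard` (H+).  H+ is stated
over FAMILIES: `∃ r : ℕ → ℕ, Y : ∀ n, ℝ^{n×n}_{≥0}` such that every member
`Q_n = per[(Y n)_{rows<r n}; x^{(n-r n)}]` is hyperbolic w.r.t. `𝟙` and
`∀ c ∃ n`, the closed cone `Λ₊(Q_n, 𝟙)` has no lifted-LMI description of size
`≤ 2^((log₂ n + c)^c)`.  The route's two-layer plan foresees two children of H+ — `NotAShadow`
(one permanental cone that is no spectrahedral shadow at all, a Scheiderer-type obstruction) and
`SlackPsdRank` (super-quasi-polynomial lift size along a sequence of cones).  This file proves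
that these two children EXHAUST H+, in a family-free (pointwise) form:

* `permanentalConeHard_of_exists_nonShadow` — **NotAShadow ⇒ H+**: a single `n` and nonnegative
  `(r, Y)` with `Q(𝟙) ≠ 0` whose cone `Λ₊(Q, 𝟙)` is not a spectrahedral shadow of ANY size give H+
  (the family is `Q` at `n` and the all-ones members elsewhere; every level `c` is witnessed at
  the same `n`).  So H+ follows from a failure of the (shadow form of the) generalized Lax
  conjecture at one permanental cone.
* `permanentalConeHard_of_frequently_large` — **infinitely-often super-qp lift size ⇒ H+**: if for
  every level `c` and every `N` some `n ≥ N` carries a nonnegative permanental cone with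
  `Q(𝟙) ≠ 0` and no lifted LMI of size `≤ 2^((log₂ n + c)^c)`, then H+ (diagonal selection: level
  `c` is witnessed at the `n` chosen for `(c, N := c)`; on each fibre of `c ↦ n` the data of the
  LARGEST level is kept, which serves all smaller levels by monotonicity of the bound in `c`).
* `exists_nonShadow_or_frequently_large_of_permanentalConeHard` — **H+ ⇒ NotAShadow ∨
  infinitely-often**: if every member of an H+ family is a shadow of some finite size, the sizes
  below any `N` are bounded by some `R`, and level `c + R` of H+ can only be witnessed at an
  `n ≥ N` (the bound `2^((log₂ n + c + R)^(c+R))` exceeds `R`), where it also witnesses level `c`.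
* `permanentalConeHard_iff_nonShadow_or_frequently_large` (= registered infrastructure stub
  `stub_hardDichotomy`) — the equivalence.

Consequences recorded for the planners (docstrings only): refuting H+ means BOTH proving that every
nonnegative permanental cone is a spectrahedral shadow (the permanental case of the Netzer–Sanyal
conjecture, open for these singular cones) AND bounding the size quasi-polynomially for all large
`n`; proving H+ means ONE of the two pointwise statements.  Everything here is proved in full;
the only route facts used are the landed `permanentalHyperbolic_proof` (real-rootedness of
nonnegative permanental polynomials) and `eval_rowPermanent`.

References: Gouveia–Parrilo–Thomas, *Lifts of convex sets and cone factorizations*, Math. Oper.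
Res. 38 (2013) (lift size); Netzer–Sanyal, Math. Program. 153 (2015) p. 6 (the shadow conjecture);
the route file `Theses/PermanentalCones.lean` (two-layer plan: NotAShadow / SlackPsdRank).
-/

set_option linter.dupNamespace false

noncomputable section

namespace Summit.ValiantsHypothesis.ValiantsHypothesis.Theorems.PermanentalConesPermanentalConeHard

open MvPolynomial Finset
open scoped BigOperators
open Literature.AlgebraicGeometry.HyperbolicPolynomials
open Summit.ValiantsHypothesis.ValiantsHypothesis.Theses.PermanentalCones (PermanentalConeHard)

namespace Dichotomy

variable {n : ℕ}

/-- The inline lifted-LMI clause of the route items is `IsSpectrahedralShadowOfSize` of the closed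
hyperbolicity cone w.r.t. `𝟙` (`x + τ • 𝟙 = (x_j + τ)_j`). [folklore] -/
theorem isSpectrahedralShadowOfSize_cone_one_iff (P : MvPolynomial (Fin n) ℝ) (m : ℕ) :
    IsSpectrahedralShadowOfSize (hyperbolicityCone P (fun _ => (1 : ℝ))) m ↔
      ∃ (p : ℕ) (A : (Fin n → ℝ) × (Fin p → ℝ) →ₗ[ℝ] Matrix (Fin m) (Fin m) ℝ)
        (B : Matrix (Fin m) (Fin m) ℝ), ∀ x : Fin n → ℝ,
          (∀ τ : ℝ, 0 < τ → MvPolynomial.eval (fun j => x j + τ) P ≠ 0) ↔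
            ∃ y : Fin p → ℝ, (A (x, y) + B).PosSemidef := by
  have hline : ∀ (x : Fin n → ℝ) (τ : ℝ), x + τ • (fun _ : Fin n => (1 : ℝ)) = fun j => x j + τ := by
    intro x τ
    funext j
    simp
  have hmem : ∀ x : Fin n → ℝ, x ∈ hyperbolicityCone P (fun _ => (1 : ℝ)) ↔
      ∀ τ : ℝ, 0 < τ → MvPolynomial.eval (fun j => x j + τ) P ≠ 0 := fun x =>
    (mem_hyperbolicityCone_iff _ _ _).trans (forall_congr' fun τ => by rw [hline x τ])
  constructor
  · rintro ⟨p, A, B, h⟩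
    exact ⟨p, A, B, fun x => (hmem x).symm.trans (h x)⟩
  · rintro ⟨p, A, B, h⟩
    exact ⟨p, A, B, fun x => (hmem x).trans (h x)⟩

/-- `Q(𝟙) > 0` for the ALL-ONES member `per[J_{rows<r}; x^{(n-r)}]`: at `x = 𝟙` the matrix is the
all-ones matrix, whose permanent is `n! > 0`. [folklore] -/
theorem eval_one_rowPermanent_allOnes_pos (n r : ℕ) :
    0 < MvPolynomial.eval (fun _ => (1 : ℝ)) (Matrix.of fun a b : Fin n =>
        if (a : ℕ) < r then C ((fun _ _ => (1 : ℝ)) a b) else (X b : MvPolynomial (Fin n) ℝ)).permanent := by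
  rw [eval_rowPermanent]
  have hmat : (Matrix.of fun a b : Fin n =>
      if (a : ℕ) < r then (fun _ _ => (1 : ℝ)) a b else (fun _ => (1 : ℝ)) b) =
      Matrix.of fun _ _ : Fin n => (1 : ℝ) := by
    ext a b
    simp only [Matrix.of_apply]
    split_ifs <;> rfl
  rw [hmat]
  unfold Matrix.permanent
  simp only [Matrix.of_apply, Finset.prod_const_one, Finset.sum_const, Finset.card_univ,
    nsmul_eq_mul, mul_one]
  exact_mod_cast Fintype.card_pos

/-- Monotonicity of the size bound `2^((log₂ n + c)^c)` in the level `c`. [folklore] -/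
theorem bound_mono (n : ℕ) {c c' : ℕ} (h : c ≤ c') :
    2 ^ ((Nat.log 2 n + c) ^ c) ≤ 2 ^ ((Nat.log 2 n + c') ^ c') := by
  refine Nat.pow_le_pow_right (by norm_num) ?_
  rcases Nat.eq_zero_or_pos c' with hc' | hc'
  · subst hc'
    obtain rfl : c = 0 := Nat.le_zero.1 h
    exact le_rfl
  · calc (Nat.log 2 n + c) ^ c ≤ (Nat.log 2 n + c') ^ c := Nat.pow_le_pow_left (by omega) _
      _ ≤ (Nat.log 2 n + c') ^ c' := Nat.pow_le_pow_right (by omega) h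

/-- The size bound at level `c` is at least `c`. [folklore] -/
theorem le_bound (n c : ℕ) : c ≤ 2 ^ ((Nat.log 2 n + c) ^ c) := by
  have h1 : c ≤ 2 ^ c := (Nat.lt_two_pow_self).le
  refine h1.trans (Nat.pow_le_pow_right (by norm_num) ?_)
  rcases Nat.eq_zero_or_pos c with hc | hc
  · subst hc
    simp
  · calc c = c ^ 1 := (pow_one c).symm
      _ ≤ (Nat.log 2 n + c) ^ 1 := Nat.pow_le_pow_left (by omega) _
      _ ≤ (Nat.log 2 n + c) ^ c := Nat.pow_le_pow_right (by omega) hc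

/-- Reindexing a constant matrix along `n = n'` does not change the permanental polynomial's
relevant properties: transport lemma proved by `subst`. [folklore] -/
theorem transport {n n' : ℕ} (e : n = n') (r : ℕ) (Y : Fin n' → Fin n' → ℝ)
    (Φ : ∀ k : ℕ, MvPolynomial (Fin k) ℝ → Prop)
    (h : Φ n' (Matrix.of fun a b : Fin n' =>
      if (a : ℕ) < r then C (Y a b) else (X b : MvPolynomial (Fin n') ℝ)).permanent) :
    Φ n (Matrix.of fun a b : Fin n =>
      if (a : ℕ) < r then C (Y (Fin.cast e a) (Fin.cast e b)) else (X b : MvPolynomial (Fin n) ℝ)).permanent := by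
  subst e
  have hc : ∀ a : Fin n, Fin.cast rfl a = a := fun a => Fin.ext rfl
  simp only [hc]
  exact h

end Dichotomy

open Dichotomy

/-- **NotAShadow ⇒ H+.**  If ONE nonnegative permanental cone `Λ₊(per[(Y)_{rows<r}; x^{(n-r)}], 𝟙)`
with `Q(𝟙) ≠ 0` is not a spectrahedral shadow of any size, then `PermanentalConeHard` holds: the
witness family is `Q` at `n` and the all-ones members `per[J_{rows<r}; x^{(k-r)}]` at `k ≠ n`
(all hyperbolic by the landed `PermanentalHyperbolic`), and every level `c` is witnessed at `n`.
[folklore] -/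
theorem permanentalConeHard_of_exists_nonShadow
    (h : ∃ (n r : ℕ) (Y : Matrix (Fin n) (Fin n) ℝ), (∀ i j, 0 ≤ Y i j) ∧
      MvPolynomial.eval (fun _ => (1 : ℝ)) (Matrix.of fun i j : Fin n =>
        if (i : ℕ) < r then MvPolynomial.C (Y i j) else MvPolynomial.X j).permanent ≠ 0 ∧
      ¬ IsSpectrahedralShadow (hyperbolicityCone (Matrix.of fun i j : Fin n =>
        if (i : ℕ) < r then MvPolynomial.C (Y i j) else MvPolynomial.X j).permanent
          (fun _ => (1 : ℝ)))) :
    PermanentalConeHard := by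
  classical
  obtain ⟨n₀, r₀, Y₀, hY₀, h1, hns⟩ := h
  -- the family: `Y₀` (reindexed) at `n₀`, all-ones elsewhere; `r ≡ r₀`
  refine ⟨fun _ => r₀, fun n => if e : n = n₀ then Matrix.of fun i j : Fin n =>
      Y₀ (Fin.cast e i) (Fin.cast e j) else Matrix.of fun _ _ : Fin n => (1 : ℝ), ?_, ?_⟩
  · intro n i j
    by_cases e : n = n₀
    · simp only [e, ↓reduceDIte, Matrix.of_apply]
      exact hY₀ _ _
    · simp only [e, ↓reduceDIte, Matrix.of_apply, zero_le_one]
  · intro P hP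
    -- `Q_n(𝟙) ≠ 0` for every member
    have h1ne : ∀ n, MvPolynomial.eval (fun _ => (1 : ℝ)) (P n) ≠ 0 := by
      intro n
      rw [hP n]
      by_cases e : n = n₀
      · simp only [e, ↓reduceDIte, Matrix.of_apply]
        subst e
        have hc : ∀ a : Fin n, Fin.cast rfl a = a := fun a => Fin.ext rfl
        simp only [hc]
        exact h1
      · simp only [e, ↓reduceDIte, Matrix.of_apply]
        exact (eval_one_rowPermanent_allOnes_pos n r₀).ne'
    refine ⟨fun n => ⟨h1ne n, fun x z hz => ?_⟩, fun c => ⟨n₀, fun m _ p A B hrep => hns ⟨m, ?_⟩⟩⟩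
    · -- real-rootedness: the landed support item `PermanentalHyperbolic`
      exact Summit.ValiantsHypothesis.ValiantsHypothesis.Theorems.permanentalHyperbolic_proof
        n r₀ _ (fun i j => by
          show 0 ≤ (if e : n = n₀ then Matrix.of fun i j : Fin n => Y₀ (Fin.cast e i) (Fin.cast e j)
            else Matrix.of fun _ _ : Fin n => (1 : ℝ)) i j
          by_cases e : n = n₀
          · simp only [e, ↓reduceDIte, Matrix.of_apply]
            exact hY₀ _ _
          · simp only [e, ↓reduceDIte, Matrix.of_apply, zero_le_one]) (P n) (hP n) (h1ne n) x z hz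
    · -- a purported lifted LMI of the member at `n₀` is one of `Λ₊(Q, 𝟙)`
      have hPn : P n₀ = (Matrix.of fun i j : Fin n₀ =>
          if (i : ℕ) < r₀ then MvPolynomial.C (Y₀ i j) else MvPolynomial.X j).permanent := by
        rw [hP n₀]
        simp only [↓reduceDIte, Matrix.of_apply]
        have hc : ∀ a : Fin n₀, Fin.cast rfl a = a := fun a => Fin.ext rfl
        simp only [hc]
      rw [hPn] at hrep
      exact (isSpectrahedralShadowOfSize_cone_one_iff _ m).2 ⟨p, A, B, hrep⟩

/-- **Selection lemma** (the diagonal assembly behind `permanentalConeHard_of_frequently_large`):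
given, for every level `c`, a size `g c ≥ c` and nonnegative data `(r₀ c, Y₀ c)` at `g c` with
`Q(𝟙) ≠ 0` and no lifted LMI of size `≤ 2^((log₂ (g c) + c)^c)`, H+ holds.  The family keeps at
each `n` in the range of `g` the data of the LARGEST `c ≤ n` with `g c = n` (a finite, nonempty
fibre since `c ≤ g c`), and the all-ones member elsewhere. [folklore] -/
theorem permanentalConeHard_of_selection (g : ℕ → ℕ) (hg : ∀ c, c ≤ g c) (r₀ : ℕ → ℕ)
    (Y₀ : ∀ c : ℕ, Matrix (Fin (g c)) (Fin (g c)) ℝ) (hY₀ : ∀ c i j, 0 ≤ Y₀ c i j)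
    (h1 : ∀ c, MvPolynomial.eval (fun _ => (1 : ℝ)) (Matrix.of fun i j : Fin (g c) =>
        if (i : ℕ) < r₀ c then MvPolynomial.C (Y₀ c i j) else MvPolynomial.X j).permanent ≠ 0)
    (hbad : ∀ c, ∀ m ≤ 2 ^ ((Nat.log 2 (g c) + c) ^ c),
      ¬ IsSpectrahedralShadowOfSize (hyperbolicityCone (Matrix.of fun i j : Fin (g c) =>
        if (i : ℕ) < r₀ c then MvPolynomial.C (Y₀ c i j) else MvPolynomial.X j).permanent
          (fun _ => (1 : ℝ))) m) :
    PermanentalConeHard := by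
  classical
  -- fibres of `g` below `n` and their maxima
  let S : ℕ → Finset ℕ := fun n => (Finset.range (n + 1)).filter fun c => g c = n
  have hS : ∀ {n c}, c ∈ S n ↔ c ≤ n ∧ g c = n := fun {n c} => by
    simp only [S, Finset.mem_filter, Finset.mem_range, Nat.lt_succ_iff]
  have hSelf : ∀ c, c ∈ S (g c) := fun c => hS.2 ⟨hg c, rfl⟩
  -- the equation `n = g (max fibre)` on a nonempty fibre
  have hEq : ∀ (n : ℕ) (hn : (S n).Nonempty), n = g ((S n).max' hn) := fun n hn =>
    (hS.1 (Finset.max'_mem _ hn)).2.symm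
  -- the family
  let r : ℕ → ℕ := fun n => if hn : (S n).Nonempty then r₀ ((S n).max' hn) else r₀ 0
  let Y : ∀ n : ℕ, Matrix (Fin n) (Fin n) ℝ := fun n =>
    if hn : (S n).Nonempty then Matrix.of fun i j : Fin n =>
      Y₀ ((S n).max' hn) (Fin.cast (hEq n hn) i) (Fin.cast (hEq n hn) j)
    else Matrix.of fun _ _ : Fin n => (1 : ℝ)
  have hYnn : ∀ n i j, 0 ≤ Y n i j := by
    intro n i j
    by_cases hn : (S n).Nonempty
    · simp only [Y, hn, ↓reduceDIte, Matrix.of_apply]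
      exact hY₀ _ _ _
    · simp only [Y, hn, ↓reduceDIte, Matrix.of_apply, zero_le_one]
  refine ⟨r, Y, hYnn, fun P hP => ?_⟩
  -- members on nonempty fibres are the transported data; elsewhere all-ones
  have hPfib : ∀ (n : ℕ) (hn : (S n).Nonempty), P n = (Matrix.of fun i j : Fin n =>
      if (i : ℕ) < r₀ ((S n).max' hn) then
        MvPolynomial.C (Y₀ ((S n).max' hn) (Fin.cast (hEq n hn) i) (Fin.cast (hEq n hn) j))
      else MvPolynomial.X j).permanent := by
    intro n hn
    rw [hP n]
    simp only [r, Y, hn, ↓reduceDIte, Matrix.of_apply]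
  have hPout : ∀ n : ℕ, ¬ (S n).Nonempty → P n = (Matrix.of fun i j : Fin n =>
      if (i : ℕ) < r₀ 0 then MvPolynomial.C ((fun _ _ => (1 : ℝ)) i j)
      else MvPolynomial.X j).permanent := by
    intro n hn
    rw [hP n]
    simp only [r, Y, hn, ↓reduceDIte, Matrix.of_apply]
  -- `Q_n(𝟙) ≠ 0` for every member
  have h1ne : ∀ n, MvPolynomial.eval (fun _ => (1 : ℝ)) (P n) ≠ 0 := by
    intro n
    by_cases hn : (S n).Nonempty
    · rw [hPfib n hn]
      exact transport (hEq n hn) _ _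
        (fun k Q => MvPolynomial.eval (fun _ => (1 : ℝ)) Q ≠ 0) (h1 _)
    · rw [hPout n hn]
      exact (eval_one_rowPermanent_allOnes_pos n (r₀ 0)).ne'
  refine ⟨fun n => ⟨h1ne n, fun x z hz => ?_⟩, fun c => ?_⟩
  · -- real-rootedness: the landed support item `PermanentalHyperbolic`
    exact Summit.ValiantsHypothesis.ValiantsHypothesis.Theorems.permanentalHyperbolic_proof
      n (r n) (Y n) (hYnn n) (P n) (hP n) (h1ne n) x z hz
  · -- level `c` is witnessed at `n := g c`, by the data of the largest level on that fibre
    have hn : (S (g c)).Nonempty := ⟨c, hSelf c⟩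
    have hcle : c ≤ (S (g c)).max' hn := Finset.le_max' _ _ (hSelf c)
    refine ⟨g c, fun m hm p A B hrep => ?_⟩
    rw [hPfib (g c) hn] at hrep
    have hshadow := (isSpectrahedralShadowOfSize_cone_one_iff _ m).2 ⟨p, A, B, hrep⟩
    refine transport (hEq (g c) hn) (r₀ ((S (g c)).max' hn)) (Y₀ ((S (g c)).max' hn))
      (fun k Q => ¬ IsSpectrahedralShadowOfSize (hyperbolicityCone Q (fun _ => (1 : ℝ))) m)
      (hbad _ m ?_) hshadow
    -- `m ≤ bound(g c, c) ≤ bound(g c, c_max) = bound(g (c_max), c_max)`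
    have hgc : g ((S (g c)).max' hn) = g c := (hS.1 (Finset.max'_mem _ hn)).2
    rw [hgc]
    exact hm.trans (bound_mono (g c) hcle)

/-- **Infinitely-often super-quasi-polynomial lift size ⇒ H+.**  If for every level `c` and every
`N` some `n ≥ N` carries a nonnegative permanental cone with `Q(𝟙) ≠ 0` admitting no lifted LMI
of size `≤ 2^((log₂ n + c)^c)`, then `PermanentalConeHard`. [folklore] -/
theorem permanentalConeHard_of_frequently_large
    (h : ∀ c N : ℕ, ∃ n : ℕ, N ≤ n ∧ ∃ (r : ℕ) (Y : Matrix (Fin n) (Fin n) ℝ), (∀ i j, 0 ≤ Y i j) ∧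
      MvPolynomial.eval (fun _ => (1 : ℝ)) (Matrix.of fun i j : Fin n =>
        if (i : ℕ) < r then MvPolynomial.C (Y i j) else MvPolynomial.X j).permanent ≠ 0 ∧
      ∀ m ≤ 2 ^ ((Nat.log 2 n + c) ^ c),
        ¬ IsSpectrahedralShadowOfSize (hyperbolicityCone (Matrix.of fun i j : Fin n =>
          if (i : ℕ) < r then MvPolynomial.C (Y i j) else MvPolynomial.X j).permanent
            (fun _ => (1 : ℝ))) m) :
    PermanentalConeHard := by
  choose g hg r₀ Y₀ hY₀ h1 hbad using fun c => h c c
  exact permanentalConeHard_of_selection g hg r₀ Y₀ hY₀ h1 hbad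

/-- **H+ ⇒ NotAShadow ∨ infinitely-often.**  If H+ holds and every nonnegative permanental cone
with `Q(𝟙) ≠ 0` is a spectrahedral shadow of some size, then for every level `c` and every `N`
some `n ≥ N` carries a nonnegative permanental cone with no lifted LMI of size
`≤ 2^((log₂ n + c)^c)`: the members of the H+ family below `N` have sizes `≤ R`, level `c + R`
of H+ is witnessed at some `n`, necessarily `≥ N` (the bound exceeds `R`), and that member also
witnesses level `c`. [folklore] -/
theorem exists_nonShadow_or_frequently_large_of_permanentalConeHard (hH : PermanentalConeHard) :
    (∃ (n r : ℕ) (Y : Matrix (Fin n) (Fin n) ℝ), (∀ i j, 0 ≤ Y i j) ∧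
      MvPolynomial.eval (fun _ => (1 : ℝ)) (Matrix.of fun i j : Fin n =>
        if (i : ℕ) < r then MvPolynomial.C (Y i j) else MvPolynomial.X j).permanent ≠ 0 ∧
      ¬ IsSpectrahedralShadow (hyperbolicityCone (Matrix.of fun i j : Fin n =>
        if (i : ℕ) < r then MvPolynomial.C (Y i j) else MvPolynomial.X j).permanent
          (fun _ => (1 : ℝ)))) ∨
    (∀ c N : ℕ, ∃ n : ℕ, N ≤ n ∧ ∃ (r : ℕ) (Y : Matrix (Fin n) (Fin n) ℝ), (∀ i j, 0 ≤ Y i j) ∧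
      MvPolynomial.eval (fun _ => (1 : ℝ)) (Matrix.of fun i j : Fin n =>
        if (i : ℕ) < r then MvPolynomial.C (Y i j) else MvPolynomial.X j).permanent ≠ 0 ∧
      ∀ m ≤ 2 ^ ((Nat.log 2 n + c) ^ c),
        ¬ IsSpectrahedralShadowOfSize (hyperbolicityCone (Matrix.of fun i j : Fin n =>
          if (i : ℕ) < r then MvPolynomial.C (Y i j) else MvPolynomial.X j).permanent
            (fun _ => (1 : ℝ))) m) := by
  classical
  by_cases hns : ∃ (n r : ℕ) (Y : Matrix (Fin n) (Fin n) ℝ), (∀ i j, 0 ≤ Y i j) ∧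
      MvPolynomial.eval (fun _ => (1 : ℝ)) (Matrix.of fun i j : Fin n =>
        if (i : ℕ) < r then MvPolynomial.C (Y i j) else MvPolynomial.X j).permanent ≠ 0 ∧
      ¬ IsSpectrahedralShadow (hyperbolicityCone (Matrix.of fun i j : Fin n =>
        if (i : ℕ) < r then MvPolynomial.C (Y i j) else MvPolynomial.X j).permanent
          (fun _ => (1 : ℝ)))
  · exact Or.inl hns
  refine Or.inr fun c N => ?_
  push Not at hns
  obtain ⟨r, Y, hY, hfam⟩ := hH
  set P : ∀ n : ℕ, MvPolynomial (Fin n) ℝ := fun n => (Matrix.of fun i j : Fin n =>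
    if (i : ℕ) < r n then MvPolynomial.C (Y n i j) else MvPolynomial.X j).permanent with hPdef
  obtain ⟨hhyp, hbad⟩ := hfam P (fun n => rfl)
  -- every member is a shadow of some size (no NotAShadow witness)
  have hsz : ∀ n, ∃ m, IsSpectrahedralShadowOfSize (hyperbolicityCone (P n) (fun _ => (1 : ℝ))) m :=
    fun n => hns n (r n) (Y n) (hY n) (hhyp n).1
  choose msz hmsz using hsz
  -- sizes below `N` are bounded by `R`; go to level `c + R`
  set R : ℕ := (Finset.range N).sup msz with hR
  obtain ⟨n, hn⟩ := hbad (c + R)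
  have hnN : N ≤ n := by
    by_contra hlt
    push Not at hlt
    have hmR : msz n ≤ R := Finset.le_sup (f := msz) (Finset.mem_range.2 hlt)
    have hmb : msz n ≤ 2 ^ ((Nat.log 2 n + (c + R)) ^ (c + R)) :=
      hmR.trans ((Nat.le_add_left R c).trans (le_bound n (c + R)))
    obtain ⟨p, A, B, hrep⟩ := (isSpectrahedralShadowOfSize_cone_one_iff _ _).1 (hmsz n)
    exact hn (msz n) hmb p A B hrep
  refine ⟨n, hnN, r n, Y n, hY n, (hhyp n).1, fun m hm hshadow => ?_⟩
  obtain ⟨p, A, B, hrep⟩ := (isSpectrahedralShadowOfSize_cone_one_iff _ _).1 hshadow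
  exact hn m (hm.trans (bound_mono n (Nat.le_add_right c R))) p A B hrep

/-- **Pointwise normal form of H+** (`PermanentalConeHard ↔ NotAShadow ∨ PsdRankUnbounded`):
H+ holds iff EITHER some nonnegative permanental cone with `Q(𝟙) ≠ 0` is not a spectrahedral
shadow of any size, OR for every level `c` there are arbitrarily large `n` carrying a nonnegative
permanental cone with `Q(𝟙) ≠ 0` and no lifted LMI of size `≤ 2^((log₂ n + c)^c)`.  In
particular `¬ H+` is the conjunction "every nonnegative permanental cone is a spectrahedral shadow"
∧ "eventually (in `n`) all of them have lifted LMIs of size `≤ 2^((log₂ n + c₀)^c₀)` for one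
`c₀`". [folklore] -/
theorem permanentalConeHard_iff_nonShadow_or_frequently_large :
    PermanentalConeHard ↔
    ((∃ (n r : ℕ) (Y : Matrix (Fin n) (Fin n) ℝ), (∀ i j, 0 ≤ Y i j) ∧
      MvPolynomial.eval (fun _ => (1 : ℝ)) (Matrix.of fun i j : Fin n =>
        if (i : ℕ) < r then MvPolynomial.C (Y i j) else MvPolynomial.X j).permanent ≠ 0 ∧
      ¬ IsSpectrahedralShadow (hyperbolicityCone (Matrix.of fun i j : Fin n =>
        if (i : ℕ) < r then MvPolynomial.C (Y i j) else MvPolynomial.X j).permanent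
          (fun _ => (1 : ℝ)))) ∨
    (∀ c N : ℕ, ∃ n : ℕ, N ≤ n ∧ ∃ (r : ℕ) (Y : Matrix (Fin n) (Fin n) ℝ), (∀ i j, 0 ≤ Y i j) ∧
      MvPolynomial.eval (fun _ => (1 : ℝ)) (Matrix.of fun i j : Fin n =>
        if (i : ℕ) < r then MvPolynomial.C (Y i j) else MvPolynomial.X j).permanent ≠ 0 ∧
      ∀ m ≤ 2 ^ ((Nat.log 2 n + c) ^ c),
        ¬ IsSpectrahedralShadowOfSize (hyperbolicityCone (Matrix.of fun i j : Fin n =>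
          if (i : ℕ) < r then MvPolynomial.C (Y i j) else MvPolynomial.X j).permanent
            (fun _ => (1 : ℝ))) m)) :=
  ⟨exists_nonShadow_or_frequently_large_of_permanentalConeHard,
    fun h => h.elim permanentalConeHard_of_exists_nonShadow permanentalConeHard_of_frequently_large⟩

/-- Registered form (`stub_hardDichotomy`, infrastructure stub of the crux `PermanentalConeHard`):
the pointwise normal form `H+ ↔ NotAShadow ∨ PsdRankUnbounded`, fully qualified. [folklore] -/
theorem stub_hardDichotomy : Summit.ValiantsHypothesis.ValiantsHypothesis.Theses.PermanentalCones.PermanentalConeHard ↔ ((∃ (n r : ℕ) (Y : Matrix (Fin n) (Fin n) ℝ), (∀ i j, 0 ≤ Y i j) ∧ MvPolynomial.eval (fun _ => (1 : ℝ)) (Matrix.of fun i j : Fin n => if (i : ℕ) < r then MvPolynomial.C (Y i j) else MvPolynomial.X j).permanent ≠ 0 ∧ ¬ Literature.AlgebraicGeometry.HyperbolicPolynomials.IsSpectrahedralShadow (Literature.AlgebraicGeometry.HyperbolicPolynomials.hyperbolicityCone (Matrix.of fun i j : Fin n => if (i : ℕ) < r then MvPolynomial.C (Y i j) else MvPolynomial.X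 j).permanent (fun _ => (1 : ℝ)))) ∨ (∀ c N : ℕ, ∃ n : ℕ, N ≤ n ∧ ∃ (r : ℕ) (Y : Matrix (Fin n) (Fin n) ℝ), (∀ i j, 0 ≤ Y i j) ∧ MvPolynomial.eval (fun _ => (1 : ℝ)) (Matrix.of fun i j : Fin n => if (i : ℕ) < r then MvPolynomial.C (Y i j) else MvPolynomial.X j).permanent ≠ 0 ∧ ∀ m ≤ 2 ^ ((Nat.log 2 n + c) ^ c), ¬ Literature.AlgebraicGeometry.HyperbolicPolynomials.IsSpectrahedralShadowOfSize (Literature.AlgebraicGeometry.HyperbolicPolynomials.hyperbolicityCone (Matrix.of fun i j : Fin n => if (i : ℕ) < r then MvPolynomial.C (Y i j) else MvPolynomial.X j).permanent (fun _ => (1 : ℝ))) m)) :=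
  permanentalConeHard_iff_nonShadow_or_frequently_large

end Summit.ValiantsHypothesis.ValiantsHypothesis.Theorems.PermanentalConesPermanentalConeHard

end
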